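import Summits.Parity.GeneralizedHardyLittlewood.Theorems.BeyondDiagonalBeatsQuarter.KernelFormXSqErrors
import HarnessLib

/-!
# Route `PrimeLevelFamEdge`, crux K_B `BeyondDiagonalBeatsQuarter` (stmt-Parity-20343), line
# `diagonal_kernel_split`: registered stub N `stub_kernelFormXSq` — the q-free `X²` kernel asymptotics

**Statement (the registered signature, verbatim).** With the KMV mollifier coefficients at the
profile `P = X²`, `x_m = μ(m)ψ(m)⁻¹(log(M/m)/log M)²`, and the typed diagonal second-moment kernel
`K_L(m₁,m₂) = KMV2000.kmvKernel L m₁ m₂` ([KowalskiMichelVanderKam2000] (21)–(23): Petersson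
diagonal ∘ Hecke recursion, leading residue of the `W`-integral, affine in the level parameter
`L = log q̂`): there are `C, M₀` such that for all `M ≥ M₀` and `0 ≤ L ≤ log M`,

  `|Σ_{m₁,m₂ ≤ M} x_{m₁}x_{m₂}K_L(m₁,m₂) − 4ζ(2)²(L/log M + 1)/log²M| ≤ C/log³M`   (`ζ(2) = π²/6`).

**Proof (this file assembles the helper files `KernelFormXSq*.lean`).**
1. Selberg coordinates (tree bridge `quadForm_kmvKernel_eq_scForm`, `KernelFormXSqBridge`):
   `Σ x x K = ℓ⁻⁴Σ_n φ(n)W(n)²((L + κ(n))S_n² + 2S_nP_n)`, `ℓ = log M`, `W = μ/(id·ψ)`,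
   `S_n = Σ_{k ≤ M/n,(k,n)=1} τ(k)W(k)log²(M/(nk))`, `P_n = Σ_{p ≤ M/n, p∤n}(log p/(p+1))S_{np}`.
2. Core (`KernelFormXSqCore`, from the `1/ζ²` Riesz mean `KernelFormXSqRiesz`, the local factors
   `KernelFormXSqLocal*` and the Euler product `KernelFormXSqEuler`): `S_n = 2E_n + δ_n`,
   `|δ_n| ≤ C_δ D(n)/(1 + log(M/n))²`, `|S_n| ≤ C_S D(n)`, `E_n = ζ(2)∏_{p∣n}(p+1)/(p−1)`,
   `D(n) = Σ_{d∣n}d^{−3/4}`.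
3. Exact collapses (`KernelFormXSqCollapse`): `φW²E = ζ(2)|W|`, `Σ|W|S = W₂(M)`,
   `Σ|W|P = Σ|W|log n·S = W₃(M) − ℓW₂(M)`, with `W₂ = 2ζ(2)ℓ + O(1)`, `W₃ = 3ζ(2)ℓ² + O(ℓ)`
   (tree `abs_weightLogPowSum_sub_le`). Hence the numerator is
   `2ζ(2)LW₂ + 4ζ(2)(W₃ − ℓW₂) + [LR₁ + X + 2R₂] = 4ζ(2)²(Lℓ + ℓ²) + O(ℓ)`.
4. Error sums (`KernelFormXSqSums*`, `KernelFormXSqErrors`): `|R₁| = |Σ φW²δS| ≪ Σ D²/(n(1+log(M/n))²) ≪ 1`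
   (dyadic), `|X| = ΣφW²κS² ≪ Σ κD²/n ≪ ℓ`, `|R₂| = |ΣφW²δP| ≪ Σ D²/n ≪ ℓ` (`|P_n| ≪ D(n)(log(M/n)+2)`
   by Chebyshev). With `L ≤ ℓ` the total error is `≪ ℓ`, i.e. `≪ ℓ⁻³` after dividing by `ℓ⁴`.

`stub_kernelFormXSq` is filed BY NAME AND SIGNATURE under
`Summit.Parity.GeneralizedHardyLittlewood.Theses.PrimeLevelFamEdge` (as the earlier stub D,
`stub_mollifierMainTermXSq`, p526832). No Theses statement is asserted; standard axioms only.
What this is NOT: it says nothing about the heart stub `stub_kernelDiagonalUpperOnPrimeAverageXSq`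
(the level-averaged second moment), nor about K_B itself. No Landau–Siegel theorem is proved by this.
«The programme SEARCHES and TYPES; no claim about Landau–Siegel zeros, Theorems 1–2 of
arXiv:2211.02515 or a repaired Margin232 until a kernel theorem says so.»

## References
* E. Kowalski, P. Michel, J. VanderKam, J. reine angew. Math. 526 (2000) 1–34, (21)–(23) pp. 12–13,
  Prop. 5.1 (31) p. 18. [cite: KowalskiMichelVanderKam2000, Prop. 5.1 — derivation (P = X², all M)]
-/

noncomputable section

open scoped Real ArithmeticFunction.Moebius ArithmeticFunction.sigma ArithmeticFunction.zeta
open Finset ArithmeticFunction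

namespace Summit.Parity.GeneralizedHardyLittlewood.Theorems.BeyondDiagonalBeatsQuarter.KernelFormXSq

open Literature.NumberTheory.LFunctions Literature.NumberTheory.LFunctions.KMV2000
open MollifierMainTerm (W weightLogPowSum abs_weightLogPowSum_sub_le)
open SelbergCoord (kappa)

/-! ### The numerator: exact main terms plus three error sums -/

/-- **Decomposition of the numerator.** For `M > 0` and every `L`:
`Σ_n φW²((L+κ)S² + 2SP) = 2ζ(2)L·W₂ + 4ζ(2)(W₃ − ℓW₂) + (L·R₁ + X + 2R₂)` with
`R₁ = ΣφW²(S−2E)S`, `X = ΣφW²κS²`, `R₂ = ΣφW²(S−2E)P` (`φW²E = ζ(2)|W|` and the three collapses).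
[cite: KowalskiMichelVanderKam2000, Prop. 5.1 — derivation] -/
theorem numerator_eq {M : ℝ} (hM : 0 < M) (L : ℝ) :
    ∑ n ∈ Icc 1 ⌊M⌋₊, (Nat.totient n : ℝ) * W n ^ 2 *
        ((L + kappa n) * coprimeSum n (M / n) ^ 2 + 2 * (coprimeSum n (M / n) * primeSum M n)) =
      2 * (π ^ 2 / 6) * L * weightLogPowSum 2 M +
        4 * (π ^ 2 / 6) * (weightLogPowSum 3 M - Real.log M * weightLogPowSum 2 M) +
        (L * ∑ n ∈ Icc 1 ⌊M⌋₊, (Nat.totient n : ℝ) * W n ^ 2 *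
            ((coprimeSum n (M / n) - 2 * mainConst n) * coprimeSum n (M / n)) +
          ∑ n ∈ Icc 1 ⌊M⌋₊, (Nat.totient n : ℝ) * W n ^ 2 * (kappa n * coprimeSum n (M / n) ^ 2) +
          2 * ∑ n ∈ Icc 1 ⌊M⌋₊, (Nat.totient n : ℝ) * W n ^ 2 *
            ((coprimeSum n (M / n) - 2 * mainConst n) * primeSum M n)) := by
  have hterm : ∀ n ∈ Icc 1 ⌊M⌋₊, (Nat.totient n : ℝ) * W n ^ 2 *
      ((L + kappa n) * coprimeSum n (M / n) ^ 2 + 2 * (coprimeSum n (M / n) * primeSum M n)) =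
      L * (2 * (π ^ 2 / 6) * (|W n| * coprimeSum n (M / n))) +
        2 * (2 * (π ^ 2 / 6) * (|W n| * primeSum M n)) +
        (L * ((Nat.totient n : ℝ) * W n ^ 2 *
            ((coprimeSum n (M / n) - 2 * mainConst n) * coprimeSum n (M / n))) +
          (Nat.totient n : ℝ) * W n ^ 2 * (kappa n * coprimeSum n (M / n) ^ 2) +
          2 * ((Nat.totient n : ℝ) * W n ^ 2 *
            ((coprimeSum n (M / n) - 2 * mainConst n) * primeSum M n))) := by
    intro n hn
    have hn0 : n ≠ 0 := by have := (Finset.mem_Icc.1 hn).1; omega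
    have hkey := totient_mul_W_sq_mul_mainConst hn0
    linear_combination (2 * L * coprimeSum n (M / n) + 4 * primeSum M n) * hkey
  rw [Finset.sum_congr rfl hterm]
  simp only [Finset.sum_add_distrib, ← Finset.mul_sum]
  rw [sum_absW_coprimeSum M, sum_absW_primeSum M, sum_absW_log_coprimeSum hM]
  ring

/-! ### The q-free `X²` kernel asymptotics -/

/-- **The q-free kernel asymptotics of the KMV second mollified moment at the profile `X²`** (with
the coefficients abbreviated by `xsq`): there are `C, M₀` with
`|Σ_{a,b ≤ M} x_a x_b K_L(a,b) − 4ζ(2)²(L/log M + 1)/log²M| ≤ C/log³M` for `M ≥ M₀`, `0 ≤ L ≤ log M`.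
[cite: KowalskiMichelVanderKam2000, Prop. 5.1 — derivation (P = X², uniformly in the mollifier length)] -/
theorem kernelForm_xsq_asymp :
    ∃ C M₀ : ℝ, ∀ M : ℝ, M₀ ≤ M → ∀ L : ℝ, 0 ≤ L → L ≤ Real.log M →
      |∑ a ∈ Icc 1 ⌊M⌋₊, ∑ b ∈ Icc 1 ⌊M⌋₊, xsq M a * xsq M b * kmvKernel L a b -
          4 * (π ^ 2 / 6) ^ 2 * (L / Real.log M + 1) / Real.log M ^ 2| ≤ C / Real.log M ^ 3 := by
  obtain ⟨C_δ, hCδ0, hδ⟩ := abs_coprimeSum_sub_le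
  obtain ⟨C_S, hCS0, hS⟩ := abs_coprimeSum_le
  obtain ⟨C₂, hW2⟩ := abs_weightLogPowSum_sub_le (j := 2) le_rfl
  obtain ⟨C₃, hW3⟩ := abs_weightLogPowSum_sub_le (j := 3) (by norm_num)
  set Z₂ : ℝ := (∑' d : ℕ, (d : ℝ) ^ (-(5 / 4 : ℝ))) ^ 2 with hZ₂
  have hZ0 : 0 ≤ Z₂ := sq_nonneg _
  set ζ2 : ℝ := π ^ 2 / 6 with hζ2
  have hζ0 : 0 < ζ2 := by positivity
  set C₂' : ℝ := max C₂ 0 with hC₂'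
  set C₃' : ℝ := max C₃ 0 with hC₃'
  set K : ℝ := 6 * ζ2 * C₂' + 4 * ζ2 * C₃' + 8 * C_δ * C_S * Z₂ + 144 * C_S ^ 2 * Z₂ +
    24 * C_δ * C_S * Z₂ with hK
  refine ⟨K, 3, fun M hM L hL0 hLℓ ↦ ?_⟩
  have hM1 : 1 ≤ M := by linarith
  have hM0 : 0 < M := by linarith
  set ℓ : ℝ := Real.log M with hℓ
  have hlog3 : (1 : ℝ) ≤ Real.log 3 := by
    rw [Real.le_log_iff_exp_le (by norm_num)]
    have := Real.exp_one_lt_d9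
    linarith
  have hℓ1 : 1 ≤ ℓ := hlog3.trans (Real.log_le_log (by norm_num) hM)
  have hℓ0 : 0 < ℓ := by linarith
  -- the two asymptotic inputs
  have hr2 : |weightLogPowSum 2 M - 2 * ζ2 * ℓ| ≤ C₂' := by
    have h := hW2 M hM
    norm_num at h
    have e : weightLogPowSum 2 M - 2 * ζ2 * ℓ = weightLogPowSum 2 M - ζ2 * 2 * Real.log M := by
      rw [hℓ]; ring
    rw [e]
    exact h.trans (le_max_left _ _)
  have hr3 : |weightLogPowSum 3 M - 3 * ζ2 * ℓ ^ 2| ≤ C₃' * ℓ := by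
    have h := hW3 M hM
    norm_num at h
    have e : weightLogPowSum 3 M - 3 * ζ2 * ℓ ^ 2 = weightLogPowSum 3 M - ζ2 * 3 * Real.log M ^ 2 := by
      rw [hℓ]; ring
    rw [e]
    exact h.trans (mul_le_mul_of_nonneg_right (le_max_left _ _) hℓ0.le)
  -- the three error sums
  have hR1 := abs_errSum_one_le hδ hS hM1
  have hX := abs_errSum_kappa_le hS hM1
  have hR2 := abs_errSum_two_le hδ hS hM1
  -- Step 1: Selberg coordinates and the numerator
  rw [quadForm_xsq_eq M L, numerator_eq hM0 L]
  set W₂ := weightLogPowSum 2 M with hW₂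
  set W₃ := weightLogPowSum 3 M with hW₃
  set R₁ := ∑ n ∈ Icc 1 ⌊M⌋₊, (Nat.totient n : ℝ) * W n ^ 2 *
    ((coprimeSum n (M / n) - 2 * mainConst n) * coprimeSum n (M / n)) with hR₁
  set X := ∑ n ∈ Icc 1 ⌊M⌋₊, (Nat.totient n : ℝ) * W n ^ 2 * (kappa n * coprimeSum n (M / n) ^ 2) with hXd
  set R₂ := ∑ n ∈ Icc 1 ⌊M⌋₊, (Nat.totient n : ℝ) * W n ^ 2 *
    ((coprimeSum n (M / n) - 2 * mainConst n) * primeSum M n) with hR₂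
  -- the difference to the main term, over `ℓ⁴`
  have hdiff : (2 * ζ2 * L * W₂ + 4 * ζ2 * (W₃ - ℓ * W₂) + (L * R₁ + X + 2 * R₂)) / ℓ ^ 4 -
      4 * ζ2 ^ 2 * (L / ℓ + 1) / ℓ ^ 2 =
      (2 * ζ2 * L * (W₂ - 2 * ζ2 * ℓ) + 4 * ζ2 * (W₃ - 3 * ζ2 * ℓ ^ 2) - 4 * ζ2 * ℓ * (W₂ - 2 * ζ2 * ℓ) +
        (L * R₁ + X + 2 * R₂)) / ℓ ^ 4 := by
    field_simp
    ring
  rw [hdiff, abs_div, abs_of_pos (by positivity : (0 : ℝ) < ℓ ^ 4)]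
  -- bound the numerator by `K ℓ`
  have hnum : |2 * ζ2 * L * (W₂ - 2 * ζ2 * ℓ) + 4 * ζ2 * (W₃ - 3 * ζ2 * ℓ ^ 2) -
      4 * ζ2 * ℓ * (W₂ - 2 * ζ2 * ℓ) + (L * R₁ + X + 2 * R₂)| ≤ K * ℓ := by
    have h1 : |2 * ζ2 * L * (W₂ - 2 * ζ2 * ℓ)| ≤ 2 * ζ2 * ℓ * C₂' := by
      rw [abs_mul, abs_of_nonneg (by positivity)]
      exact mul_le_mul (by nlinarith) hr2 (abs_nonneg _) (by positivity)
    have h2 : |4 * ζ2 * (W₃ - 3 * ζ2 * ℓ ^ 2)| ≤ 4 * ζ2 * (C₃' * ℓ) := by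
      rw [abs_mul, abs_of_nonneg (by positivity)]
      exact mul_le_mul_of_nonneg_left hr3 (by positivity)
    have h3 : |4 * ζ2 * ℓ * (W₂ - 2 * ζ2 * ℓ)| ≤ 4 * ζ2 * ℓ * C₂' := by
      rw [abs_mul, abs_of_nonneg (by positivity)]
      exact mul_le_mul_of_nonneg_left hr2 (by positivity)
    have h4 : |L * R₁| ≤ ℓ * (C_δ * C_S * (8 * Z₂)) := by
      rw [abs_mul, abs_of_nonneg hL0]
      exact mul_le_mul hLℓ hR1 (abs_nonneg _) hℓ0.le
    have h5 : |X| ≤ C_S ^ 2 * (48 * Z₂ * (2 + ℓ)) := hX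
    have h6 : |2 * R₂| ≤ 2 * (4 * C_δ * C_S * (Z₂ * (2 + ℓ))) := by
      rw [abs_mul, abs_two]; exact mul_le_mul_of_nonneg_left hR2 zero_le_two
    have hℓ3 : 2 + ℓ ≤ 3 * ℓ := by linarith
    have ha : C_S ^ 2 * (48 * Z₂ * (2 + ℓ)) ≤ C_S ^ 2 * (48 * Z₂ * (3 * ℓ)) := by gcongr
    have hb : 2 * (4 * C_δ * C_S * (Z₂ * (2 + ℓ))) ≤ 2 * (4 * C_δ * C_S * (Z₂ * (3 * ℓ))) := by gcongr
    have e1 := abs_add_le (2 * ζ2 * L * (W₂ - 2 * ζ2 * ℓ) + 4 * ζ2 * (W₃ - 3 * ζ2 * ℓ ^ 2) -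
      4 * ζ2 * ℓ * (W₂ - 2 * ζ2 * ℓ)) (L * R₁ + X + 2 * R₂)
    have e2 := abs_sub (2 * ζ2 * L * (W₂ - 2 * ζ2 * ℓ) + 4 * ζ2 * (W₃ - 3 * ζ2 * ℓ ^ 2))
      (4 * ζ2 * ℓ * (W₂ - 2 * ζ2 * ℓ))
    have e3 := abs_add_le (2 * ζ2 * L * (W₂ - 2 * ζ2 * ℓ)) (4 * ζ2 * (W₃ - 3 * ζ2 * ℓ ^ 2))
    have e4 := abs_add_three (L * R₁) X (2 * R₂)
    have htot : |2 * ζ2 * L * (W₂ - 2 * ζ2 * ℓ) + 4 * ζ2 * (W₃ - 3 * ζ2 * ℓ ^ 2) -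
        4 * ζ2 * ℓ * (W₂ - 2 * ζ2 * ℓ) + (L * R₁ + X + 2 * R₂)| ≤
        2 * ζ2 * ℓ * C₂' + 4 * ζ2 * (C₃' * ℓ) + 4 * ζ2 * ℓ * C₂' +
          (ℓ * (C_δ * C_S * (8 * Z₂)) + C_S ^ 2 * (48 * Z₂ * (3 * ℓ)) +
            2 * (4 * C_δ * C_S * (Z₂ * (3 * ℓ)))) := by
      linarith
    refine htot.trans (le_of_eq ?_)
    rw [hK]
    ring
  calc |2 * ζ2 * L * (W₂ - 2 * ζ2 * ℓ) + 4 * ζ2 * (W₃ - 3 * ζ2 * ℓ ^ 2) -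
        4 * ζ2 * ℓ * (W₂ - 2 * ζ2 * ℓ) + (L * R₁ + X + 2 * R₂)| / ℓ ^ 4
      ≤ K * ℓ / ℓ ^ 4 := div_le_div_of_nonneg_right hnum (by positivity)
    _ = K / ℓ ^ 3 := by field_simp

end Summit.Parity.GeneralizedHardyLittlewood.Theorems.BeyondDiagonalBeatsQuarter.KernelFormXSq

/-! ### The registered stub, by name and signature -/

namespace Summit.Parity.GeneralizedHardyLittlewood.Theses.PrimeLevelFamEdge

open Polynomial
open Literature.NumberTheory.LFunctions
open Summit.Parity.GeneralizedHardyLittlewood.Theorems.BeyondDiagonalBeatsQuarter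

/-- **Stub N of the K_B line `diagonal_kernel_split` (stmt-Parity-20343), landed — `stub_kernelFormXSq`,
verbatim the registered signature.** The KMV diagonal kernel form at the `X²` profile equals the
continued KMV main term, uniformly in the affine level parameter `L ∈ [0, log M]`:
`Σ_{m₁,m₂ ≤ M} x_{m₁}x_{m₂}·kmvKernel L m₁ m₂ = 4ζ(2)²(L/log M + 1)/log²M + O(1/log³M)`,
`x_m = μ(m)ψ(m)⁻¹(log(M/m)/log M)²`. This is q-free two-dimensional Möbius–divisor arithmetic, valid for
every mollifier length; it says nothing about the heart stub (the level-averaged second moment) and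
no Landau–Siegel theorem is proved by this.
[cite: KowalskiMichelVanderKam2000, (21)–(23) and Prop. 5.1 (31) p. 18 — derivation (P = X², all M)] -/
theorem stub_kernelFormXSq :
    ∃ C M₀ : ℝ, ∀ M : ℝ, M₀ ≤ M → ∀ L : ℝ, 0 ≤ L → L ≤ Real.log M →
      |(∑ m₁ ∈ Icc 1 ⌊M⌋₊, ∑ m₂ ∈ Icc 1 ⌊M⌋₊,
          ((ArithmeticFunction.moebius m₁ : ℝ) *
              ((KMV2000.psi m₁)⁻¹ * (X ^ 2 : ℝ[X]).eval (Real.log (M / m₁) / Real.log M))) *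
            ((ArithmeticFunction.moebius m₂ : ℝ) *
              ((KMV2000.psi m₂)⁻¹ * (X ^ 2 : ℝ[X]).eval (Real.log (M / m₂) / Real.log M))) *
            KMV2000.kmvKernel L m₁ m₂) -
        4 * (π ^ 2 / 6) ^ 2 * (L / Real.log M + 1) / Real.log M ^ 2| ≤ C / Real.log M ^ 3 := by
  obtain ⟨C, M₀, h⟩ := KernelFormXSq.kernelForm_xsq_asymp
  refine ⟨C, M₀, fun M hM L hL0 hL1 ↦ ?_⟩
  have hx : ∀ m : ℕ, (ArithmeticFunction.moebius m : ℝ) *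
      ((KMV2000.psi m)⁻¹ * (X ^ 2 : ℝ[X]).eval (Real.log (M / m) / Real.log M)) = KernelFormXSq.xsq M m := by
    intro m
    simp only [KernelFormXSq.xsq, Polynomial.eval_pow, Polynomial.eval_X]
  simp only [hx]
  exact h M hM L hL0 hL1

end Summit.Parity.GeneralizedHardyLittlewood.Theses.PrimeLevelFamEdge
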